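import Mathlib
import Literature.AlgebraicGeometry.Resolution.OneDimAnalyticallyUnramified
import Literature.AlgebraicGeometry.Resolution.FlatSlicingCriterion
import HarnessLib

/-!
# The `δ`-invariant of a one-dimensional local domain with finite normalization

Topic: `Literature/AlgebraicGeometry/Resolution`. Infrastructure for the termination of steps 1–2
of the algorithm of [CoP1] = Cossart–Piltant, J. Algebra 320 (2008), proof of Prop. 4.4, p. 10:
"By embedded resolution of curves, we have `s(i) ≥ 2` for `i >> 0`. … By embedded resolution of
(reducible) curves, we have `s(i) ≥ 3` for `i >> 0`" — the classical fact that blowing up singular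
points of a reduced excellent curve finitely often makes it regular, measured by the
**`δ`-invariant** `δ(R) = length_R(R̄/R)` of the local rings `R = 𝒪_{C,x}` (`R̄` the normalization,
a finite `R`-module for excellent `R`: `OneDimAnalyticallyUnramifiedFinite`). This file: the
invariant and its basic properties, for a Noetherian local domain `R` of dimension one whose
normalization `R̄ = integralClosure R (Frac R)` is module-finite (all PROVED, [folklore] /
Kollár 2007 §1.4):

* `baseSubmodule R` — `R ⊆ R̄` as an `R`-submodule; `curveDelta R = length_R(R̄/R) : ℕ∞`;
* `exists_ne_zero_smul_mem_baseSubmodule` — a common denominator `c ≠ 0` with `c R̄ ⊆ R`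
  (the conductor is non-zero);
* `isFiniteLength_normalizationQuotient`, `curveDelta_ne_top` — **`δ(R) < ∞`** (`R̄/R` is a
  finitely generated module over the Artinian ring `R/(c)`);
* `curveDelta_eq_zero_iff_isIntegrallyClosed`, `curveDelta_eq_zero_iff_isDiscreteValuationRing` —
  **`δ(R) = 0` iff `R` is normal iff `R` is a discrete valuation ring (regular)**.

## Sources

* J. Kollár, *Lectures on Resolution of Singularities*, Ann. of Math. Stud. 166 (2007), §1.4
  (resolving curve singularities by blowing up; finiteness of normalization, Thm. 1.101–1.102).
  [Kollar2007]
* V. Cossart, O. Piltant, J. Algebra 320 (2008) 1051–1082, proof of Prop. 4.4, p. 10 ("by embedded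
  resolution of curves"). [CossartPiltant2008]
-/

noncomputable section

open IsLocalRing

namespace Literature.AlgebraicGeometry.Resolution

universe u v

section Delta

variable (R : Type u) [CommRing R] [IsDomain R] (K : Type v) [Field K] [Algebra R K]
  [IsFractionRing R K]

/-- **`R ⊆ R̄`** as an `R`-submodule of the normalization `R̄ = integralClosure R K`, `K` the
fraction field. [folklore] -/
def baseSubmodule : Submodule R (integralClosure R K) :=
  LinearMap.range (Algebra.linearMap R (integralClosure R K))

omit [IsDomain R] [IsFractionRing R K] in
/-- Membership in `baseSubmodule`. [folklore] -/
theorem mem_baseSubmodule_iff {w : integralClosure R K} :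
    w ∈ baseSubmodule R K ↔ ∃ r : R, algebraMap R (integralClosure R K) r = w :=
  LinearMap.mem_range

/-- **The `δ`-invariant `δ(R) = length_R(R̄/R)`** of a local domain (Kollár §1.4; for the local
ring of a curve at a point, the number of conditions imposed by the singularity). [cite: Kollar2007, §1.4] -/
def curveDelta : ℕ∞ :=
  Module.length R (integralClosure R K ⧸ baseSubmodule R K)

variable {R}

/-- Every element of `R̄ ⊆ K` is a quotient of elements of `R` (birationality). [folklore] -/
theorem exists_smul_mem_baseSubmodule (w : integralClosure R K) :
    ∃ b : R, b ≠ 0 ∧ b • w ∈ baseSubmodule R K := by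
  obtain ⟨a, b, hb, hab⟩ := IsFractionRing.div_surjective (A := R) (w : K)
  have hb0 : (b : R) ≠ 0 := nonZeroDivisors.ne_zero hb
  have hbK : algebraMap R K b ≠ 0 :=
    fun h => hb0 (IsFractionRing.injective R K (by rw [h, map_zero]))
  refine ⟨b, hb0, (mem_baseSubmodule_iff R K).mpr ⟨a, Subtype.ext ?_⟩⟩
  change algebraMap R K a = ((b : R) • w : integralClosure R K)
  rw [Subalgebra.coe_smul, ← hab, Algebra.smul_def]
  field_simp

/-- **A common denominator**: if `R̄` is module-finite over `R` there is `c ≠ 0` in `R` with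
`c R̄ ⊆ R` (product of the denominators of a finite generating set). [cite: Kollar2007, §1.4] -/
theorem exists_ne_zero_smul_mem_baseSubmodule [Module.Finite R (integralClosure R K)] :
    ∃ c : R, c ≠ 0 ∧ ∀ w : integralClosure R K, c • w ∈ baseSubmodule R K := by
  classical
  obtain ⟨s, hs⟩ := Module.Finite.fg_top (R := R) (M := integralClosure R K)
  choose b hb0 hb using exists_smul_mem_baseSubmodule (R := R) (K := K)
  refine ⟨∏ w ∈ s, b w, Finset.prod_ne_zero_iff.mpr fun w _ => hb0 w, fun w => ?_⟩
  have hw : w ∈ Submodule.span R (s : Set (integralClosure R K)) := by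
    rw [hs]; exact Submodule.mem_top
  induction hw using Submodule.span_induction with
  | mem x hx =>
    rw [← Finset.mul_prod_erase s b hx, mul_comm, mul_smul]
    exact Submodule.smul_mem _ _ (hb x)
  | zero => rw [smul_zero]; exact Submodule.zero_mem _
  | add x y _ _ hx hy => rw [smul_add]; exact Submodule.add_mem _ hx hy
  | smul a x _ hx => rw [smul_comm]; exact Submodule.smul_mem _ _ hx

/-- In a one-dimensional Noetherian local domain every non-zero element generates an ideal
containing a power of `𝔪`. [folklore] -/
theorem exists_pow_maximalIdeal_le_span_singleton [IsNoetherianRing R] [IsLocalRing R]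
    (hdim : ringKrullDim R = 1) {c : R} (hc0 : c ≠ 0) :
    ∃ n : ℕ, maximalIdeal R ^ n ≤ Ideal.span {c} := by
  haveI : Ring.KrullDimLE 1 R := Ring.krullDimLE_iff.mpr hdim.le
  haveI : Ring.DimensionLEOne R :=
    ⟨fun hne hp => (Ring.krullDimLE_one_iff_of_noZeroDivisors.mp inferInstance) _ hne hp⟩
  have hrad : Ideal.span {c} ≠ ⊥ := by
    rw [Ne, Ideal.span_singleton_eq_bot]; exact hc0
  -- every prime over `(c)` is `𝔪`
  have hle : maximalIdeal R ≤ (Ideal.span {c}).radical := by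
    rw [Ideal.radical_eq_sInf]
    refine le_sInf ?_
    rintro P ⟨hcP, hP⟩
    have hP0 : P ≠ ⊥ := fun h => hrad (le_bot_iff.mp (h ▸ hcP))
    haveI := hP
    have hPmax : P.IsMaximal :=
      Ring.DimensionLEOne.maximalOfPrime hP0 hP
    exact (IsLocalRing.eq_maximalIdeal hPmax).ge
  exact Ideal.exists_pow_le_of_le_radical_of_fg hle (IsNoetherian.noetherian _)

/-- **`δ(R) < ∞`**: `R̄/R` has finite length when `R` is a one-dimensional Noetherian local domain
with module-finite normalization (it is a finitely generated module over the Artinian ring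
`R/(c)`, `c` a common denominator). [cite: Kollar2007, §1.4] -/
theorem isFiniteLength_normalizationQuotient [IsNoetherianRing R] [IsLocalRing R]
    (hdim : ringKrullDim R = 1) [Module.Finite R (integralClosure R K)] :
    IsFiniteLength R (integralClosure R K ⧸ baseSubmodule R K) := by
  classical
  obtain ⟨c, hc0, hc⟩ := exists_ne_zero_smul_mem_baseSubmodule (R := R) (K := K)
  by_cases hcu : IsUnit c
  · -- then `R̄ = R`
    have htop : baseSubmodule R K = ⊤ := by
      refine eq_top_iff.mpr fun w _ => ?_
      have h := Submodule.smul_mem _ (hcu.unit⁻¹ : Rˣ).1 (hc w)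
      rwa [smul_smul, IsUnit.val_inv_mul, one_smul] at h
    haveI : Subsingleton (integralClosure R K ⧸ baseSubmodule R K) :=
      Submodule.Quotient.subsingleton_iff.mpr htop
    exact IsFiniteLength.of_subsingleton
  obtain ⟨n, hn⟩ := exists_pow_maximalIdeal_le_span_singleton hdim hc0
  -- `A = R/(c)` is an Artinian ring and `R̄/R` is a finitely generated `A`-module
  have hfin : IsFiniteLength R (R ⧸ Ideal.span {c}) :=
    Matsumura1987.isFiniteLength_quotient_of_pow_le hn
  haveI : IsArtinian R (R ⧸ Ideal.span {c}) :=
    ((isFiniteLength_iff_isNoetherian_isArtinian).mp hfin).2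
  haveI : IsArtinianRing (R ⧸ Ideal.span {c}) := isArtinian_of_tower R inferInstance
  have htors : Module.IsTorsionBySet R (integralClosure R K ⧸ baseSubmodule R K)
      (Ideal.span {c} : Set R) := by
    rw [Module.isTorsionBySet_span_singleton_iff]
    intro q
    obtain ⟨w, rfl⟩ := Submodule.mkQ_surjective _ q
    rw [Submodule.mkQ_apply, ← Submodule.Quotient.mk_smul, Submodule.Quotient.mk_eq_zero]
    exact hc w
  letI : Module (R ⧸ Ideal.span {c}) (integralClosure R K ⧸ baseSubmodule R K) :=
    htors.module
  haveI : IsScalarTower R (R ⧸ Ideal.span {c}) (integralClosure R K ⧸ baseSubmodule R K) :=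
    htors.isScalarTower
  haveI : Module.Finite (R ⧸ Ideal.span {c}) (integralClosure R K ⧸ baseSubmodule R K) :=
    Module.Finite.of_restrictScalars_finite R _ _
  haveI : IsArtinian R (integralClosure R K ⧸ baseSubmodule R K) :=
    isArtinian_of_surjective_algebraMap (R := R ⧸ Ideal.span {c}) (S := R)
      Ideal.Quotient.mk_surjective
  haveI : IsNoetherian R (integralClosure R K ⧸ baseSubmodule R K) :=
    isNoetherian_of_isNoetherianRing_of_finite R _
  exact isFiniteLength_iff_isNoetherian_isArtinian.mpr ⟨inferInstance, inferInstance⟩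

/-- `δ(R) < ∞`, numerically. [cite: Kollar2007, §1.4] -/
theorem curveDelta_ne_top [IsNoetherianRing R] [IsLocalRing R] (hdim : ringKrullDim R = 1)
    [Module.Finite R (integralClosure R K)] : curveDelta R K ≠ ⊤ := by
  rw [curveDelta, Module.length_ne_top_iff]
  exact isFiniteLength_normalizationQuotient K hdim

omit [IsDomain R] in
/-- **`δ(R) = 0` iff `R` is integrally closed.** [cite: Kollar2007, §1.4] -/
theorem curveDelta_eq_zero_iff_isIntegrallyClosed :
    curveDelta R K = 0 ↔ IsIntegrallyClosed R := by
  rw [curveDelta, Module.length_eq_zero_iff, Submodule.Quotient.subsingleton_iff,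
    isIntegrallyClosed_iff K]
  constructor
  · intro h x hx
    have hmem : (⟨x, hx⟩ : integralClosure R K) ∈ baseSubmodule R K := h ▸ Submodule.mem_top
    obtain ⟨r, hr⟩ := (mem_baseSubmodule_iff R K).mp hmem
    exact ⟨r, by simpa using congrArg Subtype.val hr⟩
  · intro h
    refine eq_top_iff.mpr fun w _ => ?_
    obtain ⟨r, hr⟩ := h w.2
    exact (mem_baseSubmodule_iff R K).mpr ⟨r, Subtype.ext hr⟩

/-- **`δ(R) = 0` iff `R` is a discrete valuation ring** (= regular), for a one-dimensional
Noetherian local domain. [cite: Kollar2007, §1.4] -/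
theorem curveDelta_eq_zero_iff_isDiscreteValuationRing [IsNoetherianRing R] [IsLocalRing R]
    (hdim : ringKrullDim R = 1) : curveDelta R K = 0 ↔ IsDiscreteValuationRing R := by
  rw [curveDelta_eq_zero_iff_isIntegrallyClosed]
  have hnf : ¬ IsField R := (ringKrullDim_eq_one_iff_of_isLocalRing_isDomain.mp hdim).1
  haveI : Ring.KrullDimLE 1 R := Ring.krullDimLE_iff.mpr hdim.le
  haveI : Ring.DimensionLEOne R :=
    ⟨fun hne hp => (Ring.krullDimLE_one_iff_of_noZeroDivisors.mp inferInstance) _ hne hp⟩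
  -- the unique non-zero prime is `𝔪`
  have huniq : ∃! P : Ideal R, P ≠ ⊥ ∧ P.IsPrime := by
    refine ⟨maximalIdeal R, ⟨isField_iff_maximalIdeal_eq.not.mp hnf, inferInstance⟩, ?_⟩
    rintro P ⟨hP0, hP⟩
    exact IsLocalRing.eq_maximalIdeal (Ring.DimensionLEOne.maximalOfPrime hP0 hP)
  have htfae := IsDiscreteValuationRing.TFAE R hnf
  have h03 := htfae.out 0 3
  exact ⟨fun h => h03.mpr ⟨h, huniq⟩, fun h => (h03.mp h).1⟩

omit [IsDomain R] in
/-- Finiteness of the normalization does not depend on the chosen fraction field. [folklore] -/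
theorem module_finite_integralClosure_of_isFractionRing
    [Module.Finite R (integralClosure R (FractionRing R))] : Module.Finite R (integralClosure R K) :=
  Module.Finite.equiv ((FractionRing.algEquiv R K).mapIntegralClosure).toLinearEquiv

omit [IsDomain R] in
/-- `δ` does not depend on the chosen fraction field. [folklore] -/
theorem curveDelta_eq_curveDelta (K' : Type*) [Field K'] [Algebra R K'] [IsFractionRing R K'] :
    curveDelta R K = curveDelta R K' := by
  let e : integralClosure R K ≃ₐ[R] integralClosure R K' :=
    ((FractionRing.algEquiv R K).symm.trans (FractionRing.algEquiv R K')).mapIntegralClosure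
  have hmap : (baseSubmodule R K).map e.toLinearEquiv.toLinearMap = baseSubmodule R K' := by
    apply le_antisymm
    · rintro _ ⟨w, hw, rfl⟩
      obtain ⟨r, rfl⟩ := (mem_baseSubmodule_iff R K).mp hw
      exact (mem_baseSubmodule_iff R K').mpr ⟨r, (e.commutes r).symm⟩
    · intro w hw
      obtain ⟨r, rfl⟩ := (mem_baseSubmodule_iff R K').mp hw
      exact ⟨algebraMap R _ r, (mem_baseSubmodule_iff R K).mpr ⟨r, rfl⟩, e.commutes r⟩
  exact (Submodule.Quotient.equiv (baseSubmodule R K) (baseSubmodule R K') e.toLinearEquiv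
    hmap).length_eq

end Delta

end Literature.AlgebraicGeometry.Resolution

end
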